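import Summits.AtomisticToContinuum.FouriersLaw.Theorems.PhononMeanFreePathIncoherentChannelLeftSensitivitySmooth
import Summits.AtomisticToContinuum.FouriersLaw.Theorems.PhononMeanFreePathIncoherentChannelLeftSensitivity
import Summits.AtomisticToContinuum.FouriersLaw.Theorems.PhononMeanFreePathIncoherentChannelCommonPastBudget

/-!
# `IncoherentChannel`, line `two-horizons-forecast-loss` — the LEFT-SENSITIVITY BUDGET of the forecast (assembly)

Lead assembly (c4, cycle 2) of three registered helper stubs of crux `PhononMeanFreePath.IncoherentChannel`
(stmt-AtomisticToContinuum-11811, route `PhononMeanFreePath`, sub-problem `FouriersLaw`) from the three files landed by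
the cycle-2 wave. Vocabulary of `PhononMeanFreePathDefs`: `P = pinnedChain ω₂ lam β γ`, the `(N+1)`-site chain with both
Langevin baths at `T`, `μ₀ = P.gibbsMeasure (N+1) T`, `K_s = P.transitionKernel (N+1) T T s⁺`, `ν = N(0,T)`,
`v_s = fcast … N s = K_s p_N` (mean forecast of the far bath momentum), and for `x = (z, σ)` the RESAMPLED state
`z̃ = (z.1, z.2[0 ↦ σ])` (the near-bath momentum replaced by a fresh Gaussian). The LEFT-SENSITIVITY functional

  `D_N(s) = ∫ (v_s(z) − v_s(z̃))² d(μ₀ ⊗ ν)`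

measures how much the far forecast feels the initial near-bath momentum; it is the ONE functional that controls both
cross terms of the line (`lightCone_reduction`: `r_N² ≤ T·D_N`, `|P_N| ≤ K√D_N`, `K = K(T)`).

* `leftSensitivity_budget_holds` — **the N-uniform budget** `∫_{0<s≤t} D_N(s) ds ≤ π²T/(8γ)` for every `N`, `t > 0`:
  the smooth budget for `F ∈ C_c` (`leftSensitivity_budget_smooth`, p141137: resampling Gaussian Poincaré inequality in
  `p_0` × the `i = 0` tap of the time-resolved dissipation inequality) pushed to `F = p_N` by truncation
  (`leftSensitivity_budget_of_smooth`, p141544).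
* `leftSensitivity_budget` — the registered conditional form (hypothesis: the resampling Poincaré inequality, itself landed
  as `resamplePoincare_zero`, p140315), now a corollary.
* `commonPast_sq_integral_le` — **the N-uniform `L²(dt)` budget of the common-past term** `P_N = Cov_{μ₀}(p_0², v_t²)`:
  `∫₀^∞ P_N(s)² ds ≤ C(T, γ)` for every `N` (`commonPast_sq_integral_le_of_leftBudget`, p141111, fed the budget).

What it is worth for the line (census, honest): the budget is an integrated, `N`-uniform, unconditional statement of the
same type as the forecast budget `∫(r_N² + a_N²) ≤ T²/(2γ)` (p135026); it does NOT lower the exponent `α > 2` that the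
crux composition asks of the engine `stub_forecastLoss` for the `P_N` term (every route through `D_N` trades `t`-decay
for a power of `N`), and it is not used by `IncoherentChannel_of`. No definitions; nothing here closes an item.
-/

noncomputable section

namespace Summit.AtomisticToContinuum.FouriersLaw.Theorems.PhononMeanFreePath

open MeasureTheory Set Filter Topology ProbabilityTheory
open scoped NNReal ENNReal
open Literature.MathematicalPhysics.KineticTheory.HeatConduction

/-- **THE LEFT-SENSITIVITY BUDGET OF THE FORECAST, `N`-uniform** (registered helper `leftSensitivity_budget_holds`):
for the pinned anharmonic chain (`ω₂, β, γ > 0`, `lam ≥ 0`) with both baths at `T > 0`, every `N` and every `t > 0`,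
`∫_{0<s≤t} ∫ (v_s(z) − v_s(z̃))² d(μ₀ ⊗ N(0,T)) ds ≤ π²T/(8γ)` (`z̃` = `z` with `p_0` resampled): the far forecast
depends on the initial near-bath momentum only in an `L²(ds × μ₀ ⊗ ν)`-budgeted way, uniformly in the length of the
chain. Proof: `leftSensitivity_budget_of_smooth` applied to `leftSensitivity_budget_smooth`. [folklore] -/
theorem leftSensitivity_budget_holds : ∀ ω₂ lam β γ : ℝ, 0 < ω₂ → 0 ≤ lam → 0 < β → 0 < γ → ∀ T : ℝ, 0 < T → ∀ (N : ℕ) (t : ℝ), 0 < t → ∫⁻ s in Ioc (0 : ℝ) t, ENNReal.ofReal (∫ x : PhaseSpace (N + 1) × ℝ, (fcast ω₂ lam β γ T N s x.1 - fcast ω₂ lam β γ T N s ((x.1.1, Function.update x.1.2 0 x.2) : PhaseSpace (N + 1))) ^ 2 ∂(((pinnedChain ω₂ lam β γ).gibbsMeasure (N + 1) T).prod (ProbabilityTheory.gaussianReal 0 T.toNNReal))) ≤ ENNReal.ofReal (Real.pi ^ 2 * T / (8 * γ)) :=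
  leftSensitivity_budget_of_smooth leftSensitivity_budget_smooth

/-- **Registered conditional form** `leftSensitivity_budget` (hypothesis: the one-coordinate resampling Poincaré
inequality under the Gibbs measure, landed separately as `resamplePoincare_zero`): now an unconditional corollary of
`leftSensitivity_budget_holds`. [folklore] -/
theorem leftSensitivity_budget : (∀ ω₂ lam β γ : ℝ, 0 < ω₂ → 0 ≤ lam → 0 ≤ β → ∀ T : ℝ, 0 < T → ∀ (n : ℕ) (f : PhaseSpace (n + 1) → ℝ), ContDiff ℝ 1 f → ∫⁻ x : PhaseSpace (n + 1) × ℝ, ENNReal.ofReal ((f x.1 - f ((x.1.1, Function.update x.1.2 0 x.2) : PhaseSpace (n + 1))) ^ 2) ∂(((pinnedChain ω₂ lam β γ).gibbsMeasure (n + 1) T).prod (ProbabilityTheory.gaussianReal 0 T.toNNReal)) ≤ ENNReal.ofReal (Real.pi ^ 2 / 4 * T) * ∫⁻ x, ENNReal.ofReal ((partialP 0 f x) ^ 2) ∂((pinnedChain ω₂ lam β γ).gibbsMeasure (n + 1) T)) → ∀ ω₂ lam β γ : ℝ, 0 < ω₂ → 0 ≤ lam → 0 < β → 0 < γ → ∀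 T : ℝ, 0 < T → ∀ (N : ℕ) (t : ℝ), 0 < t → ∫⁻ s in Ioc (0 : ℝ) t, ENNReal.ofReal (∫ x : PhaseSpace (N + 1) × ℝ, (fcast ω₂ lam β γ T N s x.1 - fcast ω₂ lam β γ T N s ((x.1.1, Function.update x.1.2 0 x.2) : PhaseSpace (N + 1))) ^ 2 ∂(((pinnedChain ω₂ lam β γ).gibbsMeasure (N + 1) T).prod (ProbabilityTheory.gaussianReal 0 T.toNNReal))) ≤ ENNReal.ofReal (Real.pi ^ 2 * T / (8 * γ)) :=
  fun _ => leftSensitivity_budget_holds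

/-- **THE COMMON-PAST TERM IS `N`-UNIFORMLY SQUARE-INTEGRABLE IN TIME** (registered helper
`commonPast_sq_integral_le`): for all parameters `> 0` and `T > 0` there is `C` with
`t ↦ P_N(t)² ∈ L¹(0,∞)` and `∫₀^∞ P_N(t)² dt ≤ C` for EVERY `N`, `P_N(t) = Cov_{μ₀}(p_0², v_t²)` the common-past part
of the crux's power covariance. Proof: `commonPast_sq_integral_le_of_leftBudget` (pointwise `P_N² ≤ K²D_N` from
`lightCone_reduction`) fed the budget `leftSensitivity_budget_holds`; `C = K(T)²·π²T/(8γ)`. [folklore] -/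
theorem commonPast_sq_integral_le : ∀ ω₂ lam β γ : ℝ, 0 < ω₂ → 0 < lam → 0 < β → 0 < γ → ∀ T : ℝ, 0 < T → ∃ C : ℝ, ∀ N : ℕ, IntegrableOn (fun s => (commonPast ω₂ lam β γ T N s) ^ 2) (Ioi (0 : ℝ)) ∧ ∫ s in Ioi (0 : ℝ), (commonPast ω₂ lam β γ T N s) ^ 2 ≤ C :=
  commonPast_sq_integral_le_of_leftBudget leftSensitivity_budget_holds

end Summit.AtomisticToContinuum.FouriersLaw.Theorems.PhononMeanFreePath

end
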